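import Mathlib

/-!
# Border apolarity, crux `ToricWitnessObstructionQP` — the DECOMPRESSION identity for
# approximate determinantal representations (lead c7, `Cruxes/…/GradedNormalForm.md` Prop. 2.3)

Route `ValiantsHypothesis/BorderApolarity`, crux item `stmt-ValiantsHypothesis-14753`, line `Sketch`.

An *approximate determinantal representation of order `k`* of a polynomial `P` is a square matrix
`A` over `R[X]` (think: `A = B₀ + X B₁ + ⋯`, the `B_t` matrices of linear forms) with
`(det A).coeff t = 0` for `t < k` and `(det A).coeff k = P`; order `0` is an honest representation,
order `1` is Landsberg's splitting construction of boundary points of `Det_m` (GCT book §6.7.1), the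
tree's `determinantalComplexity_perPoly_le_of_orderRep` de-borders them, and the torus leading
forms of this crux are exactly the GRADED ones (`GradedNormalForm.md`, Thm 1.2 / Cor 3.1).

The structural fact proved here (purely algebraic, any commutative ring): if the layer-`0` matrix
`A mod X` vanishes on a block `I × J` with `|I| + |J| = m + 1` — i.e. lies in a Frobenius–Kőnig
COMPRESSION space in the given coordinates — then `det A = X · det A'` for the explicit matrix `A'`
of the same size over `R[X]` obtained by dividing the block `I × J` by `X` and multiplying the
opposite block `Iᶜ × Jᶜ` by `X`.  Hence `(det A).coeff (k+1) = (det A').coeff k`: an approximate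
representation whose layer `0` is compressed (after a constant change of basis) is never of minimal
order; at minimal order the layer-`0` pencil spans a singular space contained in NO compression space
(for `m ≤ 6` and `P` the padded `per₃` the minimal order is `≥ 1` by Alper–Bogart–Velasco).  For
order `1` this says that Landsberg's splitting polynomial `[X¹] det(B₀ + X B₁) = tr(adj B₀ · B₁)`
with compressed `B₀` is the HONEST determinant of `N = [[B₁|_{I×J}, B₀],[B₀, 0]]`.

* `rowScale_mul_mul_rowScale_eq` : `D_I * A * D_J = X • A'` for `D_I = diag(1 on I, X off I)`;
* `det_eq_X_mul_det_decompress` : `det A = X * det A'` when `|I| + |J| = card m + 1`;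
* `coeff_det_succ_eq_coeff_det_decompress`, `coeff_det_zero_eq_zero_of_block`,
  `coeff_det_one_eq_det_of_block` : coefficient shift, Frobenius–Kőnig, and the order-1 case.
-/

open Polynomial Matrix
open scoped BigOperators Polynomial

-- the mandated summit-side namespace repeats a component by design (single-problem summit)
set_option linter.dupNamespace false

namespace Summit.ValiantsHypothesis.ValiantsHypothesis.Theorems.BorderApolarityToricWitnessObstructionQP

noncomputable section

namespace Decompression

variable {R : Type*} [CommRing R] {m : Type*} [Fintype m] [DecidableEq m]

/-- Entrywise: `diag(1 on I, X off I) * A * diag(1 on J, X off J) = X • A'` where `A'` divides the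
block `I × J` by `X` (assumed to vanish mod `X` there; `Polynomial.divX` is then exact), keeps the
mixed blocks and multiplies `Iᶜ × Jᶜ` by `X`. [folklore] -/
theorem rowScale_mul_mul_rowScale_eq (A : Matrix m m R[X]) (I J : Finset m)
    (hA : ∀ i ∈ I, ∀ j ∈ J, (A i j).coeff 0 = 0) :
    Matrix.diagonal (fun i => if i ∈ I then (1 : R[X]) else X) * A *
        Matrix.diagonal (fun j => if j ∈ J then (1 : R[X]) else X) =
      (X : R[X]) • Matrix.of (fun i j =>
        if i ∈ I then (if j ∈ J then (A i j).divX else A i j)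
        else (if j ∈ J then A i j else X * A i j)) := by
  apply Matrix.ext
  intro i j
  simp only [Matrix.diagonal_mul, Matrix.mul_diagonal, Matrix.smul_apply, Matrix.of_apply,
    smul_eq_mul]
  by_cases hi : i ∈ I <;> by_cases hj : j ∈ J <;> simp only [hi, hj, if_true, if_false]
  · -- block I × J : A i j = X * divX (A i j)
    have h := Polynomial.divX_mul_X_add (A i j)
    rw [hA i hi j hj, Polynomial.C_0, add_zero] at h
    calc (1 : R[X]) * A i j * 1 = A i j := by ring
      _ = (A i j).divX * X := h.symm
      _ = X * (A i j).divX := by ring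
  · ring
  · ring
  · ring

/-- `det (diag (1 on I, X off I)) = X ^ (card m - |I|)`. [folklore] -/
theorem det_diagonal_one_X (I : Finset m) :
    (Matrix.diagonal (fun i => if i ∈ I then (1 : R[X]) else X)).det =
      X ^ (Fintype.card m - I.card) := by
  classical
  rw [Matrix.det_diagonal, Finset.prod_ite, Finset.prod_const_one, one_mul, Finset.prod_const]
  congr 1
  have h : (Finset.univ.filter fun i : m => i ∉ I) = Finset.univ \ I := by
    ext i; simp
  rw [h, Finset.card_sdiff, Finset.inter_univ, Finset.card_univ]

/-- **Decompression.**  If `A ∈ Mat_m(R[X])` vanishes mod `X` on a block `I × J` with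
`|I| + |J| = card m + 1`, then `det A = X · det A'`, `A'` = divide `I × J` by `X`, multiply
`Iᶜ × Jᶜ` by `X`. [folklore] -/
theorem det_eq_X_mul_det_decompress' (A : Matrix m m R[X]) (I J : Finset m)
    (hA : ∀ i ∈ I, ∀ j ∈ J, (A i j).coeff 0 = 0) (hIJ : I.card + J.card = Fintype.card m + 1) :
    A.det = X * (Matrix.of (fun i j =>
        if i ∈ I then (if j ∈ J then (A i j).divX else A i j)
        else (if j ∈ J then A i j else X * A i j))).det := by
  classical
  set A' : Matrix m m R[X] := Matrix.of (fun i j =>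
        if i ∈ I then (if j ∈ J then (A i j).divX else A i j)
        else (if j ∈ J then A i j else X * A i j)) with hA'
  have h := congrArg Matrix.det (rowScale_mul_mul_rowScale_eq A I J hA)
  rw [Matrix.det_mul, Matrix.det_mul, det_diagonal_one_X, det_diagonal_one_X, Matrix.det_smul,
    ← hA'] at h
  -- h : X^(n - |I|) * det A * X^(n - |J|) = X ^ n * det A'
  set n := Fintype.card m with hn
  have hI : I.card ≤ n := by rw [hn]; exact Finset.card_le_univ I
  have hJ : J.card ≤ n := by rw [hn]; exact Finset.card_le_univ J
  have hsum : (n - I.card) + (n - J.card) = n - 1 := by omega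
  have hpow : (X : R[X]) ^ n = X ^ (n - 1) * X := by
    rw [← pow_succ]; congr 1; omega
  have h' : X ^ (n - 1) * A.det = X ^ (n - 1) * (X * A'.det) := by
    calc X ^ (n - 1) * A.det = X ^ (n - I.card) * A.det * X ^ (n - J.card) := by
            rw [← hsum, pow_add]; ring
      _ = X ^ n * A'.det := h
      _ = X ^ (n - 1) * (X * A'.det) := by rw [hpow]; ring
  exact (isRegular_X_pow (R := R) (n - 1)).left h'

/-- Coefficient shift: an approximate representation with compressed layer `0` drops one order.
[folklore] -/
theorem coeff_det_succ_eq_coeff_det_decompress (A : Matrix m m R[X]) (I J : Finset m)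
    (hA : ∀ i ∈ I, ∀ j ∈ J, (A i j).coeff 0 = 0) (hIJ : I.card + J.card = Fintype.card m + 1)
    (k : ℕ) : A.det.coeff (k + 1) = (Matrix.of (fun i j =>
        if i ∈ I then (if j ∈ J then (A i j).divX else A i j)
        else (if j ∈ J then A i j else X * A i j))).det.coeff k := by
  rw [det_eq_X_mul_det_decompress' A I J hA hIJ, Polynomial.coeff_X_mul]

/-- Frobenius–Kőnig in coefficient form: with a compressed layer `0`, the constant term of
`det A` vanishes (layer `0` is a singular pencil). [folklore] -/
theorem coeff_det_zero_eq_zero_of_block (A : Matrix m m R[X]) (I J : Finset m)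
    (hA : ∀ i ∈ I, ∀ j ∈ J, (A i j).coeff 0 = 0) (hIJ : I.card + J.card = Fintype.card m + 1) :
    A.det.coeff 0 = 0 := by
  rw [det_eq_X_mul_det_decompress' A I J hA hIJ, Polynomial.coeff_X_mul_zero]

/-- **Order-1 case: a compressed splitting is an honest representation.**  With layers
`A = C B₀ + X • C B₁` and `B₀|_{I × J} = 0`, `|I| + |J| = card m + 1`, the order-`1` coefficient
of `det A` — Landsberg's splitting polynomial `tr(adj B₀ · B₁)` — is the HONEST determinant
`det N`, `N i j = B₁ i j` on `I × J`, `= B₀ i j` on the mixed blocks, `= 0` on `Iᶜ × Jᶜ`.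
[folklore] -/
theorem coeff_det_one_eq_det_of_block (B₀ B₁ : Matrix m m R) (I J : Finset m)
    (hB : ∀ i ∈ I, ∀ j ∈ J, B₀ i j = 0) (hIJ : I.card + J.card = Fintype.card m + 1) :
    (B₀.map Polynomial.C + (X : R[X]) • B₁.map Polynomial.C).det.coeff 1 =
      (Matrix.of fun i j =>
        if i ∈ I then (if j ∈ J then B₁ i j else B₀ i j)
        else (if j ∈ J then B₀ i j else 0)).det := by
  classical
  set A : Matrix m m R[X] := B₀.map Polynomial.C + (X : R[X]) • B₁.map Polynomial.C with hAdef
  have hA : ∀ i ∈ I, ∀ j ∈ J, (A i j).coeff 0 = 0 := by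
    intro i hi j hj
    simp [hAdef, Matrix.add_apply, Matrix.map_apply, Matrix.smul_apply, hB i hi j hj]
  rw [coeff_det_succ_eq_coeff_det_decompress A I J hA hIJ 0]
  -- coeff 0 of det = det of the entrywise coeff 0 (evaluation at 0 is a ring hom)
  have hcoeff : ∀ M : Matrix m m R[X], M.det.coeff 0 = (M.map (Polynomial.constantCoeff)).det := by
    intro M
    rw [← Polynomial.constantCoeff_apply, RingHom.map_det, RingHom.mapMatrix_apply]
  rw [hcoeff]
  congr 1
  ext i j
  simp only [Matrix.map_apply, Matrix.of_apply, hAdef, Matrix.add_apply,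
    Matrix.smul_apply, smul_eq_mul, Polynomial.constantCoeff_apply]
  by_cases hi : i ∈ I <;> by_cases hj : j ∈ J <;>
    simp [hi, hj, Polynomial.coeff_C_zero, hB]

end Decompression

/-- **Decompression (registered helper form).**  If `A ∈ Mat_m(R[X])` vanishes mod `X` on a block
`I × J` with `|I| + |J| = card m + 1`, then `det A = X · det A'` with `A'` obtained by dividing the
block `I × J` by `X` and multiplying `Iᶜ × Jᶜ` by `X` (`Decompression.det_eq_X_mul_det_decompress'`).
[folklore] -/
theorem det_eq_X_mul_det_decompress : ∀ {R : Type*} [CommRing R] {m : Type*} [Fintype m] [DecidableEq m] (A : Matrix m m (Polynomial R)) (I J : Finset m), (∀ i ∈ I, ∀ j ∈ J, (A i j).coeff 0 = 0) → I.card + J.card = Fintype.card m + 1 → A.det = Polynomial.X * (Matrix.of (fun i j => if i ∈ I then (if j ∈ J then (A i j).divX else A i j) else (if j ∈ J then A i j else Polynomial.X * A i j))).det :=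
  fun A I J hA hIJ => Decompression.det_eq_X_mul_det_decompress' A I J hA hIJ

end

end Summit.ValiantsHypothesis.ValiantsHypothesis.Theorems.BorderApolarityToricWitnessObstructionQP
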